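import Mathlib
import Summits.ValiantsHypothesis.ValiantsHypothesis.Theorems.FreeSubtorusOrbitDimensionBoundStubAbsorbingSacrificeFinalMatching
import Summits.ValiantsHypothesis.ValiantsHypothesis.Theorems.FreeSubtorusOrbitDimensionBoundStubAbsorbingSacrificeCofactorWeights
import Summits.ValiantsHypothesis.ValiantsHypothesis.Theorems.FreeSubtorusOrbitDimensionBoundStubAbsorbingSacrificeRelabelGeneral
import Summits.ValiantsHypothesis.ValiantsHypothesis.Theorems.FreeSubtorusOrbitDimensionBoundStubAbsorbingSacrificeTerminal
import Summits.ValiantsHypothesis.ValiantsHypothesis.Theorems.FreeSubtorusSubtorusCovering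
import Summits.ValiantsHypothesis.ValiantsHypothesis.Theorems.SchenstedIndexPowTraceCertificateTools
import HarnessLib

/-!
# Route FreeSubtorus — crux `OrbitDimensionBound` (stmt-ValiantsHypothesis-16133), line `affine_multiple` (a RUNG line:
# target `Multiple.AffineMultipleShadow`, the crux stays OPEN), registered stub 2 `stub_absorbingSacrifice`: the ASSEMBLY

`stub_absorbingSacrifice_of_terminal`: the registered statement `Stmt.stub_absorbingSacrifice` of
`Cruxes/OrbitDimensionBound/Lines/affine_multiple.lean` (with `torusGen` / `Admissible` unfolded, as for the landed stubs 1
and 3), ASSUMING the uniform pinned terminal step `terminal_pinned` (split SPEC `HOME/lmr/SPEC-p6g11-16133-stub2-split.md`,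
piece (β3), landed by val-lit-p7 g10 as `AbsorbingSacrifice.terminal_pinned`) as an explicit hypothesis `hT` whose statement is
spelled out verbatim; then `stub_absorbingSacrifice` — THE REGISTERED STUB, inline form, closed by `exact` in the skeleton — is
`stub_absorbingSacrifice_of_terminal terminal_pinned`.  Composition:
trivial exit `n ≤ r + 3`; support `S` of the linear cofactor `q` and its integer semi-invariance (`cofactor_intWeights_eq`,
p7 g10); `finalMatching` (choice of the final matching: `t ≤ r + 1` pairs, integer expansions, no free support, pin with the
constant-coefficient clauses); exit `n' ≤ 2`; relabelling (`exists_perm_extend_embedding`, `relabel_general`, support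
transport by `coeff_rename_mapDomain`); `hT` / `terminal_pinned` (pinned substitution, `T¹`-lifts through the torus extension
with roots of product one, rescaling).  With stubs 1 (`stub_cofactorShape`, p567288) and 3 (`stub_perInvariantTorusBound`, p570355)
already in `Theorems/`, every registered stub of the rung line `affine_multiple` is now a theorem.

Honest framing: a registered stub of a RUNG line (`Multiple.AffineMultipleShadow`) inside one route; the crux `OrbitDimensionBound`
(stmt-16133) and route FreeSubtorus stay OPEN; census-neutral; nothing here bears on `VP ≠ VNP` (NOT proved).  No definitions, no
named facts; unconditional (`stub_absorbingSacrifice` has no hypotheses beyond the registered statement's).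
-/

-- the mandated summit-side namespace repeats a component by design (single-conjunct summit)
set_option linter.dupNamespace false

noncomputable section

open Matrix MvPolynomial Finset
open Literature.Computability.AlgebraicComplexity

namespace Summit.ValiantsHypothesis.ValiantsHypothesis.Theorems.FreeSubtorusOrbitDimensionBound

open AbsorbingSacrifice
open Summit.ValiantsHypothesis.ValiantsHypothesis.Theorems.FreeSubtorusSubtorusCovering
  (exists_perm_extend_embedding rename_prodMap_perPoly)

/-- A position of `Fin (n' + t)` avoiding all `natAdd n' j` is a `castAdd t l`. [folklore] -/
theorem exists_castAdd_of_ne_natAdd {n' t : ℕ} (x : Fin (n' + t)) (hx : ∀ j : Fin t, x ≠ Fin.natAdd n' j) :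
    ∃ l : Fin n', x = Fin.castAdd t l := by
  by_cases h : (x : ℕ) < n'
  · exact ⟨⟨x, h⟩, Fin.ext (by simp)⟩
  · exfalso
    refine hx ⟨(x : ℕ) - n', by omega⟩ (Fin.ext ?_)
    simp only [Fin.val_natAdd]
    omega

/-- **Stub 2 modulo the pinned terminal step.**  The registered statement `Stmt.stub_absorbingSacrifice` (inline form),
from the hypothesis `hT` = the uniform pinned terminal theorem `terminal_pinned` of the split SPEC (β3).
[cite: LandsbergRessayre2017, Thm. 2.8, §6] -/
theorem stub_absorbingSacrifice_of_terminal
    (hT : ∀ (n' s r m : ℕ) (Λ : Fin r → (Fin (n' + s) ⊕ Fin (n' + s)) → ℤ)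
      (B : Matrix (Fin m) (Fin m) (MvPolynomial (Fin (n' + s) × Fin (n' + s)) ℂ))
      (q : MvPolynomial (Fin (n' + s) × Fin (n' + s)) ℂ), q.IsHomogeneous 1 →
      IsEquivariantDetRepr (Subgroup.closure
        {γ : Matrix.GeneralLinearGroup (Fin (n' + s) × Fin (n' + s)) ℂ | ∃ d e : Fin (n' + s) → ℂˣ,
          (∀ i, (∏ k, (d k) ^ (Λ i (Sum.inl k))) * (∏ l, (e l) ^ (Λ i (Sum.inr l))) = 1) ∧
          (γ : Matrix (Fin (n' + s) × Fin (n' + s)) (Fin (n' + s) × Fin (n' + s)) ℂ) =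
            Matrix.diagonal (fun p => (d p.1 : ℂ) * (e p.2 : ℂ))}) (perPoly (Fin (n' + s)) ℂ * q) B →
      1 ≤ m → 1 ≤ n' → ∀ (N : ℕ), 0 < N → ∀ (ar ac : Fin n' → Fin s → ℤ),
      (∀ k i, (N : ℤ) * Λ i (Sum.inl (Fin.castAdd s k)) =
        ∑ j, ar k j * (Λ i (Sum.inl (Fin.natAdd n' j)) - Λ i (Sum.inr (Fin.natAdd n' j)))) →
      (∀ l i, (N : ℤ) * Λ i (Sum.inr (Fin.castAdd s l)) =
        ∑ j, ac l j * (Λ i (Sum.inl (Fin.natAdd n' j)) - Λ i (Sum.inr (Fin.natAdd n' j)))) →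
      (∀ k l, MvPolynomial.coeff (Finsupp.single (Fin.castAdd s k, Fin.castAdd s l) 1) q = 0) →
      ∀ (p₀ : Fin (n' + s) × Fin (n' + s)), MvPolynomial.coeff (Finsupp.single p₀ 1) q ≠ 0 →
      ((∃ j, p₀ = (Fin.natAdd n' j, Fin.natAdd n' j)) ∨
        (∃ (j₀ : Fin s) (l₀ : Fin n') (α : ℤ), p₀ = (Fin.natAdd n' j₀, Fin.castAdd s l₀) ∧
          (∀ k, ar k j₀ = α) ∧ (∀ l, l ≠ l₀ → ac l j₀ = α) ∧ ac l₀ j₀ = α + N) ∨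
        (∃ (k₀ : Fin n') (j₀ : Fin s) (α : ℤ), p₀ = (Fin.castAdd s k₀, Fin.natAdd n' j₀) ∧
          (∀ l, ac l j₀ = α) ∧ (∀ k, k ≠ k₀ → ar k j₀ = α) ∧ ar k₀ j₀ + N = α) ∨
        (∃ (j₀ j₁ : Fin s) (α₀ α₁ : ℤ), j₀ ≠ j₁ ∧ p₀ = (Fin.natAdd n' j₀, Fin.natAdd n' j₁) ∧
          (∀ k, ar k j₀ = α₀) ∧ (∀ l, ac l j₀ = α₀) ∧ (∀ k, ar k j₁ = α₁) ∧ (∀ l, ac l j₁ = α₁))) →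
      ∃ B' : Matrix (Fin m) (Fin m) (MvPolynomial (Fin n' × Fin n') ℂ),
        IsEquivariantDetRepr (Subgroup.closure
          {γ : Matrix.GeneralLinearGroup (Fin n' × Fin n') ℂ | ∃ d e : Fin n' → ℂˣ,
            (∀ i : Fin 1, (∏ k, (d k) ^ ((fun (_ : Fin 1) (_ : Fin n' ⊕ Fin n') => (1 : ℤ)) i (Sum.inl k))) *
              (∏ l, (e l) ^ ((fun (_ : Fin 1) (_ : Fin n' ⊕ Fin n') => (1 : ℤ)) i (Sum.inr l))) = 1) ∧
            (γ : Matrix (Fin n' × Fin n') (Fin n' × Fin n') ℂ) = Matrix.diagonal (fun p => (d p.1 : ℂ) * (e p.2 : ℂ))})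
          (perPoly (Fin n') ℂ) B') :
    ∀ (n m r : ℕ) (Λ : Fin r → (Fin n ⊕ Fin n) → ℤ) (B : Matrix (Fin m) (Fin m) (MvPolynomial (Fin n × Fin n) ℂ))
      (q : MvPolynomial (Fin n × Fin n) ℂ),
      3 ≤ n → (∀ i, (∑ k, Λ i (Sum.inl k)) = 0 ∧ (∑ l, Λ i (Sum.inr l)) = 0) → q ≠ 0 → q.IsHomogeneous 1 →
      IsEquivariantDetRepr (Subgroup.closure {γ : Matrix.GeneralLinearGroup (Fin n × Fin n) ℂ |
          ∃ d e : Fin n → ℂˣ, (∀ i, (∏ k, (d k) ^ (Λ i (Sum.inl k))) * (∏ l, (e l) ^ (Λ i (Sum.inr l))) = 1) ∧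
            (γ : Matrix (Fin n × Fin n) (Fin n × Fin n) ℂ) = Matrix.diagonal (fun p => (d p.1 : ℂ) * (e p.2 : ℂ))})
        (perPoly (Fin n) ℂ * q) B →
      ∃ n' t : ℕ, n = n' + t ∧ t ≤ r + 1 ∧
        (n' ≤ 2 ∨ ∃ B' : Matrix (Fin m) (Fin m) (MvPolynomial (Fin n' × Fin n') ℂ),
          IsEquivariantDetRepr (Subgroup.closure {γ : Matrix.GeneralLinearGroup (Fin n' × Fin n') ℂ |
              ∃ d e : Fin n' → ℂˣ, (∀ i : Fin 1, (∏ k, (d k) ^ ((fun (_ : Fin 1) (_ : Fin n' ⊕ Fin n') => (1 : ℤ)) i (Sum.inl k))) *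
                  (∏ l, (e l) ^ ((fun (_ : Fin 1) (_ : Fin n' ⊕ Fin n') => (1 : ℤ)) i (Sum.inr l))) = 1) ∧
                (γ : Matrix (Fin n' × Fin n') (Fin n' × Fin n') ℂ) = Matrix.diagonal (fun p => (d p.1 : ℂ) * (e p.2 : ℂ))})
            (perPoly (Fin n') ℂ) B') := by
  intro n m r Λ B q hn hΛ hq0 hq1 hB
  classical
  -- (0) trivial exit: sacrifice `min n (r + 1)` coordinates and leave `n' ≤ 2`
  by_cases hsmall : n ≤ r + 3
  · exact ⟨n - min n (r + 1), min n (r + 1), by omega, Nat.min_le_right _ _, Or.inl (by omega)⟩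
  have hn4 : r + 4 ≤ n := by omega
  -- (1) the support of the linear form `q` and its integer semi-invariance
  set S : Finset (Fin n × Fin n) := Finset.univ.filter fun p => MvPolynomial.coeff (Finsupp.single p 1) q ≠ 0
    with hSdef
  have hmemS : ∀ p, p ∈ S ↔ MvPolynomial.coeff (Finsupp.single p 1) q ≠ 0 := fun p => by simp [hSdef]
  have hS : S.Nonempty := by
    by_contra hemp
    rw [Finset.not_nonempty_iff_eq_empty] at hemp
    apply hq0
    rw [Summit.ValiantsHypothesis.ValiantsHypothesis.Theorems.SchenstedIndex.eq_sum_coeff_single_mul_X hq1]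
    refine Finset.sum_eq_zero fun p _ => ?_
    have hp : ¬ (MvPolynomial.coeff (Finsupp.single p 1) q ≠ 0) := fun h => by
      have : p ∈ S := (hmemS p).2 h
      rw [hemp] at this
      exact Finset.notMem_empty p this
    push Not at hp
    rw [hp, C_0, zero_mul]
  have hSI : ∀ x y : Fin n → ℤ, (∀ i, (∑ k, x k * Λ i (Sum.inl k)) + (∑ l, y l * Λ i (Sum.inr l)) = 0) →
      ∀ p₁ ∈ S, ∀ p₂ ∈ S, x p₁.1 + y p₁.2 = x p₂.1 + y p₂.2 := fun x y hxy p₁ hp₁ p₂ hp₂ =>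
    cofactor_intWeights_eq n m r Λ B q hq1 hB x y hxy p₁ p₂ ((hmemS p₁).1 hp₁) ((hmemS p₂).1 hp₂)
  -- (2) the final matching
  obtain ⟨t, ι, κ, N, ar, ac, p₀, ht, hN, har, hac, hnofree, hp₀S, hpin⟩ :=
    finalMatching Λ (fun i => (hΛ i).1) S hS hSI hn4
  obtain ⟨n', rfl⟩ : ∃ n', n = n' + t := ⟨n - t, by omega⟩
  by_cases hn'2 : n' ≤ 2
  · exact ⟨n', t, rfl, ht, Or.inl hn'2⟩
  have hn' : 1 ≤ n' := by omega
  -- (3) `1 ≤ m`: a `0 × 0` determinant is `1`, but `per · q` has no constant term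
  have hm : 1 ≤ m := by
    refine Nat.one_le_iff_ne_zero.2 fun hm0 => ?_
    subst hm0
    have h1 : B.det = 1 := Matrix.det_isEmpty
    have hqc : MvPolynomial.constantCoeff q = 0 := by
      rw [MvPolynomial.constantCoeff_eq]
      exact hq1.coeff_eq_zero (by simp)
    have h2 := congrArg MvPolynomial.constantCoeff hB.1.2
    rw [h1, map_one, map_mul, hqc, mul_zero] at h2
    exact one_ne_zero h2
  -- (4) relabel: the pairs to the last `t` diagonal positions
  obtain ⟨ρ, hρ⟩ := exists_perm_extend_embedding ι (Fin.natAddEmb n')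
  obtain ⟨κ₀, hκ₀⟩ := exists_perm_extend_embedding κ (Fin.natAddEmb n')
  simp only [Fin.natAddEmb_apply] at hρ hκ₀
  have hρ' : ∀ j, ρ.symm (Fin.natAdd n' j) = ι j := fun j => by
    rw [Equiv.symm_apply_eq]; exact (hρ j).symm
  have hκ₀' : ∀ j, κ₀.symm (Fin.natAdd n' j) = κ j := fun j => by
    rw [Equiv.symm_apply_eq]; exact (hκ₀ j).symm
  -- free rows / columns after relabelling are `castAdd`
  have hρfree : ∀ k : Fin n', ρ.symm (Fin.castAdd t k) ∉ Set.range ι := by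
    rintro k ⟨j, hj⟩
    have := congrArg ρ hj
    rw [hρ j, Equiv.apply_symm_apply] at this
    exact absurd (congrArg Fin.val this) (by simp; omega)
  have hκfree : ∀ l : Fin n', κ₀.symm (Fin.castAdd t l) ∉ Set.range κ := by
    rintro l ⟨j, hj⟩
    have := congrArg κ₀ hj
    rw [hκ₀ j, Equiv.apply_symm_apply] at this
    exact absurd (congrArg Fin.val this) (by simp; omega)
  -- an unmatched original index goes to a `castAdd`
  have hρcast : ∀ x : Fin (n' + t), x ∉ Set.range ι → ∃ l : Fin n', ρ x = Fin.castAdd t l := fun x hx =>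
    exists_castAdd_of_ne_natAdd (ρ x) fun j h => hx ⟨j, by rw [← hρ' j, ← h, Equiv.symm_apply_apply]⟩
  have hκcast : ∀ x : Fin (n' + t), x ∉ Set.range κ → ∃ l : Fin n', κ₀ x = Fin.castAdd t l := fun x hx =>
    exists_castAdd_of_ne_natAdd (κ₀ x) fun j h => hx ⟨j, by rw [← hκ₀' j, ← h, Equiv.symm_apply_apply]⟩
  set Λ' : Fin r → (Fin (n' + t) ⊕ Fin (n' + t)) → ℤ := fun i =>
    Sum.elim (fun k => Λ i (Sum.inl (ρ.symm k))) (fun l => Λ i (Sum.inr (κ₀.symm l))) with hΛ'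
  set q₁ : MvPolynomial (Fin (n' + t) × Fin (n' + t)) ℂ := MvPolynomial.rename (Prod.map ρ κ₀) q with hq₁def
  set B₁ : Matrix (Fin m) (Fin m) (MvPolynomial (Fin (n' + t) × Fin (n' + t)) ℂ) :=
    B.map (MvPolynomial.rename (Prod.map ρ κ₀)) with hB₁def
  have hB₁ : IsEquivariantDetRepr (Subgroup.closure
      {γ : Matrix.GeneralLinearGroup (Fin (n' + t) × Fin (n' + t)) ℂ | ∃ d e : Fin (n' + t) → ℂˣ,
        (∀ i, (∏ k, (d k) ^ (Λ' i (Sum.inl k))) * (∏ l, (e l) ^ (Λ' i (Sum.inr l))) = 1) ∧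
        (γ : Matrix (Fin (n' + t) × Fin (n' + t)) (Fin (n' + t) × Fin (n' + t)) ℂ) =
          Matrix.diagonal (fun p => (d p.1 : ℂ) * (e p.2 : ℂ))}) (perPoly (Fin (n' + t)) ℂ * q₁) B₁ := by
    have h := relabel_general (n' + t) r m Λ (perPoly (Fin (n' + t)) ℂ * q) B ρ κ₀ hB
    rw [map_mul, rename_prodMap_perPoly] at h
    exact h
  have hq₁ : q₁.IsHomogeneous 1 := hq1.rename_isHomogeneous
  -- support transport
  have hcoeff : ∀ x y : Fin (n' + t), MvPolynomial.coeff (Finsupp.single (x, y) 1) q₁ =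
      MvPolynomial.coeff (Finsupp.single (ρ.symm x, κ₀.symm y) 1) q := by
    intro x y
    have hinj : Function.Injective (Prod.map ρ κ₀) := ρ.injective.prodMap κ₀.injective
    rw [show Finsupp.single (x, y) 1 = Finsupp.mapDomain (Prod.map ρ κ₀) (Finsupp.single (ρ.symm x, κ₀.symm y) 1) by
      rw [Finsupp.mapDomain_single]; simp, hq₁def, MvPolynomial.coeff_rename_mapDomain _ hinj]
  -- (5) the relabelled data for the terminal step
  let ar' : Fin n' → Fin t → ℤ := fun k j => ar (ρ.symm (Fin.castAdd t k)) j
  let ac' : Fin n' → Fin t → ℤ := fun l j => ac (κ₀.symm (Fin.castAdd t l)) j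
  have har' : ∀ k i, (N : ℤ) * Λ' i (Sum.inl (Fin.castAdd t k)) =
      ∑ j, ar' k j * (Λ' i (Sum.inl (Fin.natAdd n' j)) - Λ' i (Sum.inr (Fin.natAdd n' j))) := by
    intro k i
    simp only [hΛ', Sum.elim_inl, Sum.elim_inr, hρ', hκ₀', ar']
    exact har _ i
  have hac' : ∀ l i, (N : ℤ) * Λ' i (Sum.inr (Fin.castAdd t l)) =
      ∑ j, ac' l j * (Λ' i (Sum.inl (Fin.natAdd n' j)) - Λ' i (Sum.inr (Fin.natAdd n' j))) := by
    intro l i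
    simp only [hΛ', Sum.elim_inl, Sum.elim_inr, hρ', hκ₀', ac']
    exact hac _ i
  have hfree' : ∀ k l, MvPolynomial.coeff (Finsupp.single (Fin.castAdd t k, Fin.castAdd t l) 1) q₁ = 0 := by
    intro k l
    rw [hcoeff]
    by_contra h
    rcases hnofree _ ((hmemS _).2 h) with h1 | h1
    · exact hρfree k h1
    · exact hκfree l h1
  set p₀' : Fin (n' + t) × Fin (n' + t) := (ρ p₀.1, κ₀ p₀.2) with hp₀'def
  have hp₀' : MvPolynomial.coeff (Finsupp.single p₀' 1) q₁ ≠ 0 := by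
    rw [hp₀'def, hcoeff, Equiv.symm_apply_apply, Equiv.symm_apply_apply]
    exact (hmemS p₀).1 hp₀S
  have hpin' : (∃ j, p₀' = (Fin.natAdd n' j, Fin.natAdd n' j)) ∨
      (∃ (j₀ : Fin t) (l₀ : Fin n') (α : ℤ), p₀' = (Fin.natAdd n' j₀, Fin.castAdd t l₀) ∧
        (∀ k, ar' k j₀ = α) ∧ (∀ l, l ≠ l₀ → ac' l j₀ = α) ∧ ac' l₀ j₀ = α + N) ∨
      (∃ (k₀ : Fin n') (j₀ : Fin t) (α : ℤ), p₀' = (Fin.castAdd t k₀, Fin.natAdd n' j₀) ∧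
        (∀ l, ac' l j₀ = α) ∧ (∀ k, k ≠ k₀ → ar' k j₀ = α) ∧ ar' k₀ j₀ + N = α) ∨
      (∃ (j₀ j₁ : Fin t) (α₀ α₁ : ℤ), j₀ ≠ j₁ ∧ p₀' = (Fin.natAdd n' j₀, Fin.natAdd n' j₁) ∧
        (∀ k, ar' k j₀ = α₀) ∧ (∀ l, ac' l j₀ = α₀) ∧ (∀ k, ar' k j₁ = α₁) ∧ (∀ l, ac' l j₁ = α₁)) := by
    rcases hpin with ⟨j, hj⟩ | ⟨j₀, l₀, α, hp, hl₀, h1, h2, h3⟩ | ⟨k₀, j₀, α, hp, hk₀, h1, h2, h3⟩ |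
        ⟨j₀, j₁, α₀, α₁, hne, hp, h1, h2, h3, h4⟩
    · refine Or.inl ⟨j, ?_⟩
      rw [hp₀'def, hj, hρ j, hκ₀ j]
    · obtain ⟨l₀', hl₀'⟩ := hκcast l₀ hl₀
      refine Or.inr (Or.inl ⟨j₀, l₀', α, by rw [hp₀'def, hp, hρ j₀, hl₀'], fun k => h1 _ (hρfree k),
        fun l hl => h2 _ (hκfree l) (fun h => hl ?_), ?_⟩)
      · have := congrArg κ₀ h
        rw [Equiv.apply_symm_apply, hl₀'] at this
        exact Fin.castAdd_injective _ _ this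
      · show ac (κ₀.symm (Fin.castAdd t l₀')) j₀ = α + N
        rw [← hl₀', Equiv.symm_apply_apply]
        exact h3
    · obtain ⟨k₀', hk₀'⟩ := hρcast k₀ hk₀
      refine Or.inr (Or.inr (Or.inl ⟨k₀', j₀, α, by rw [hp₀'def, hp, hκ₀ j₀, hk₀'], fun l => h1 _ (hκfree l),
        fun k hk => h2 _ (hρfree k) (fun h => hk ?_), ?_⟩))
      · have := congrArg ρ h
        rw [Equiv.apply_symm_apply, hk₀'] at this
        exact Fin.castAdd_injective _ _ this
      · show ar (ρ.symm (Fin.castAdd t k₀')) j₀ + N = α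
        rw [← hk₀', Equiv.symm_apply_apply]
        exact h3
    · exact Or.inr (Or.inr (Or.inr ⟨j₀, j₁, α₀, α₁, hne, by rw [hp₀'def, hp, hρ j₀, hκ₀ j₁],
        fun k => h1 _ (hρfree k), fun l => h2 _ (hκfree l), fun k => h3 _ (hρfree k), fun l => h4 _ (hκfree l)⟩))
  -- (6) the pinned terminal step
  obtain ⟨B', hB'⟩ := hT n' t r m Λ' B₁ q₁ hq₁ hB₁ hm hn' N hN ar' ac' har' hac' hfree' p₀' hp₀' hpin'
  exact ⟨n', t, rfl, ht, Or.inr ⟨B', hB'⟩⟩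

/-- **Registered stub `stub_absorbingSacrifice` of line `affine_multiple` (crux stmt-ValiantsHypothesis-16133, rung
`Multiple.AffineMultipleShadow`)** — the `q`-ABSORBING PAIR SACRIFICE: a `T_Λ`-equivariant (exact lifts) affine representation
`B` of `per_n · q` (`q` a non-zero linear form, `Λ` admissible with `r` generators, `n ≥ 3`) yields `n = n' + t` with `t ≤ r + 1`
sacrificed pairs and, unless `n' ≤ 2`, a representation of `per_{n'}` OF THE SAME SIZE equivariant under the per-invariant torus
`T¹ = torusGen n' 1 𝟙` of the free block.  Statement = `Stmt.stub_absorbingSacrifice` with `torusGen` / `Admissible` unfolded;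
the skeleton closes its stub by `exact`.  Proof: `stub_absorbingSacrifice_of_terminal` applied to the landed terminal step
`AbsorbingSacrifice.terminal_pinned` (val-lit-p7 g10). [cite: LandsbergRessayre2017, Thm. 2.8, §6] -/
theorem stub_absorbingSacrifice :
    ∀ (n m r : ℕ) (Λ : Fin r → (Fin n ⊕ Fin n) → ℤ) (B : Matrix (Fin m) (Fin m) (MvPolynomial (Fin n × Fin n) ℂ))
      (q : MvPolynomial (Fin n × Fin n) ℂ),
      3 ≤ n → (∀ i, (∑ k, Λ i (Sum.inl k)) = 0 ∧ (∑ l, Λ i (Sum.inr l)) = 0) → q ≠ 0 → q.IsHomogeneous 1 →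
      IsEquivariantDetRepr (Subgroup.closure {γ : Matrix.GeneralLinearGroup (Fin n × Fin n) ℂ |
          ∃ d e : Fin n → ℂˣ, (∀ i, (∏ k, (d k) ^ (Λ i (Sum.inl k))) * (∏ l, (e l) ^ (Λ i (Sum.inr l))) = 1) ∧
            (γ : Matrix (Fin n × Fin n) (Fin n × Fin n) ℂ) = Matrix.diagonal (fun p => (d p.1 : ℂ) * (e p.2 : ℂ))})
        (perPoly (Fin n) ℂ * q) B →
      ∃ n' t : ℕ, n = n' + t ∧ t ≤ r + 1 ∧
        (n' ≤ 2 ∨ ∃ B' : Matrix (Fin m) (Fin m) (MvPolynomial (Fin n' × Fin n') ℂ),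
          IsEquivariantDetRepr (Subgroup.closure {γ : Matrix.GeneralLinearGroup (Fin n' × Fin n') ℂ |
              ∃ d e : Fin n' → ℂˣ, (∀ i : Fin 1, (∏ k, (d k) ^ ((fun (_ : Fin 1) (_ : Fin n' ⊕ Fin n') => (1 : ℤ)) i (Sum.inl k))) *
                  (∏ l, (e l) ^ ((fun (_ : Fin 1) (_ : Fin n' ⊕ Fin n') => (1 : ℤ)) i (Sum.inr l))) = 1) ∧
                (γ : Matrix (Fin n' × Fin n') (Fin n' × Fin n') ℂ) = Matrix.diagonal (fun p => (d p.1 : ℂ) * (e p.2 : ℂ))})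
            (perPoly (Fin n') ℂ) B') :=
  stub_absorbingSacrifice_of_terminal AbsorbingSacrifice.terminal_pinned

end Summit.ValiantsHypothesis.ValiantsHypothesis.Theorems.FreeSubtorusOrbitDimensionBound

end
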